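import Summits.HodgeConjecture.HodgeCM.Model.ArchConjTorusTransport_1

/-! PORT of `HodgeCM/Model/ArchConjTorusTransport.lean` (HodgeCMPerL run 82) — part 2: continuation of `Summits.HodgeConjecture.HodgeCM.Model.ArchConjTorusTransport_1` (split at a top-level declaration boundary by port_pkg.py; scope re-opened below; declarations unchanged). -/

-- port_pkg: scope re-opened for this part (file-level context, then the namespace/section stack open at the cut)
set_option autoImplicit false
noncomputable section
open scoped Matrix Classical ComplexConjugate
open NumberField (InfinitePlace maximalRealSubfield IsCMField)
open NumberField.mixedEmbedding (mixedSpace)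
open Literature.NumberTheory.Automorphic Literature.NumberTheory.Automorphic.UnitaryGroup Literature.NumberTheory.Weil1964
open Literature.NumberTheory.GelbartRogawski1991 Literature.NumberTheory.GelbartRogawski1991.UnitaryDualPair
open HodgeCM.Adelic HodgeCM.PerL34 HodgeCM.Model.HypCensus
namespace HodgeCM.Model.ArchSideTerm
section Transport
variable {L : CMField} (S : StubTree.SeesawDatum L)
/-- (Ported verbatim from the HodgeCMPerL package; no docstring in the source.) -/
theorem gram_aux_swap (l₀ l₁ b₀ b₁ : ℝ) :
    (!![0, (l₁ : ℂ); (l₀ : ℂ), 0])ᴴ * Matrix.diagonal ![(b₀ : ℂ), (b₁ : ℂ)] * !![0, (l₁ : ℂ); (l₀ : ℂ), 0] =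
      Matrix.diagonal ![((l₀ * l₀ * b₁ : ℝ) : ℂ), ((l₁ * l₁ * b₀ : ℝ) : ℂ)] := by
  ext i j
  fin_cases i <;> fin_cases j <;>
    simp [Matrix.mul_apply, Fin.sum_univ_two, Matrix.conjTranspose_apply, Matrix.diagonal] <;> ring

/-- (Ported verbatim from the HodgeCMPerL package; no docstring in the source.) -/
theorem gram_aux_diag (l₀ l₁ b₀ b₁ : ℝ) :
    (!![(l₀ : ℂ), 0; 0, (l₁ : ℂ)])ᴴ * Matrix.diagonal ![(b₀ : ℂ), (b₁ : ℂ)] * !![(l₀ : ℂ), 0; 0, (l₁ : ℂ)] =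
      Matrix.diagonal ![((l₀ * l₀ * b₀ : ℝ) : ℂ), ((l₁ * l₁ * b₁ : ℝ) : ℂ)] := by
  ext i j
  fin_cases i <;> fin_cases j <;>
    simp [Matrix.mul_apply, Fin.sum_univ_two, Matrix.conjTranspose_apply, Matrix.diagonal] <;> ring

/-- **unitarity through `w`**: `(P_σ Λ)ᴴ · diag(a'(w)) · (P_σ Λ) = diag(a(w))`. -/
theorem transportMatAt_gram (w : InfinitePlace (L : Type)) :
    (transportMatAt S w)ᴴ * Matrix.diagonal (fun j => w.embedding (dW' S j)) * transportMatAt S w =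
      Matrix.diagonal (fun j => w.embedding (dW S j)) := by
  have hβ : (fun j => w.embedding (dW' S j)) =
      ![(((w.embedding (dW' S 0)).re : ℝ) : ℂ), (((w.embedding (dW' S 1)).re : ℝ) : ℂ)] := by
    funext j
    fin_cases j
    exacts [embedding_dW'_eq_re S w 0, embedding_dW'_eq_re S w 1]
  have hα : (fun j => w.embedding (dW S j)) =
      ![(((w.embedding (dW S 0)).re : ℝ) : ℂ), (((w.embedding (dW S 1)).re : ℝ) : ℂ)] := by
    funext j
    fin_cases j
    exacts [embedding_dW_eq_re S w 0, embedding_dW_eq_re S w 1]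
  have e0 := transportScale_sq_mul S w 0
  have e1 := transportScale_sq_mul S w 1
  rw [hβ, hα]
  unfold transportMatAt
  by_cases h : conjSwapAt S w
  · rw [bitPerm_zero_of S w h] at e0
    rw [bitPerm_one_of S w h] at e1
    rw [if_pos h, gram_aux_swap, e0, e1]
  · rw [bitPerm_of_not S w h] at e0 e1
    rw [if_neg h, gram_aux_diag, e0, e1]

/-- **commutation through `w`**: `(P_σ Λ) · diag(ρ-mixed) = diag · (P_σ Λ)`. -/
theorem transportMatAt_mul_diagonal (w : InfinitePlace (L : Type)) (x y : ℂ) :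
    transportMatAt S w * Matrix.diagonal ![if conjSwapAt S w then y else x, if conjSwapAt S w then x else y] =
      Matrix.diagonal ![x, y] * transportMatAt S w := by
  unfold transportMatAt
  split_ifs <;>
  · ext i j
    fin_cases i <;> fin_cases j <;> simp [Matrix.mul_apply, Matrix.diagonal] <;> ring

/-- `P_σ · Λ` as a matrix over `L ⊗ ℝ` (complex coordinates `transportMatAt`; a CM field has no real coordinates). -/
def transportMat : Matrix (Fin 2) (Fin 2) (mixedSpace (L : Type)) :=
  Matrix.of fun i j => ((fun _ => 0), fun w => transportMatAt S w.1 i j)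

/-- its inverse over `L ⊗ ℝ`. -/
def transportInv : Matrix (Fin 2) (Fin 2) (mixedSpace (L : Type)) :=
  Matrix.of fun i j => ((fun _ => 0), fun w => transportInvAt S w.1 i j)

/-- (Ported verbatim from the HodgeCMPerL package; no docstring in the source.) -/
@[simp] theorem transportMat_map_evalC (w : {w : InfinitePlace (L : Type) // w.IsComplex}) :
    (transportMat S).map (evalC (L : Type) w) = transportMatAt S w.1 := rfl

/-- (Ported verbatim from the HodgeCMPerL package; no docstring in the source.) -/
@[simp] theorem transportInv_map_evalC (w : {w : InfinitePlace (L : Type) // w.IsComplex}) :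
    (transportInv S).map (evalC (L : Type) w) = transportInvAt S w.1 := rfl

/-- `P_σ · Λ ∈ GL₂(L ⊗ ℝ)`. -/
def conjTransportGL : GL (Fin 2) (mixedSpace (L : Type)) where
  val := transportMat S
  inv := transportInv S
  val_inv := matrix_mixedSpace_eq_of_evalC _ _ fun w => by
    rw [Matrix.map_mul, transportMat_map_evalC, transportInv_map_evalC, Matrix.map_one _ (map_zero _) (map_one _)]
    exact transportMatAt_mul_inv S w.1
  inv_val := matrix_mixedSpace_eq_of_evalC _ _ fun w => by
    rw [Matrix.map_mul, transportMat_map_evalC, transportInv_map_evalC, Matrix.map_one _ (map_zero _) (map_one _)]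
    exact transportInvAt_mul S w.1

/-- (Ported verbatim from the HodgeCMPerL package; no docstring in the source.) -/
@[simp] theorem val_conjTransportGL : ((conjTransportGL S : GL (Fin 2) (mixedSpace (L : Type))) : Matrix (Fin 2) (Fin 2) (mixedSpace (L : Type))) =
    transportMat S := rfl

/-- `g₀ ⊗ 1` through `w` is `g₀(w)`. -/
theorem val_archGL_map_evalC (w : {w : InfinitePlace (L : Type) // w.IsComplex}) :
    ((archGL (L : Type) S.isoGL : GL (Fin 2) (mixedSpace (L : Type))) : Matrix (Fin 2) (Fin 2) (mixedSpace (L : Type))).map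
        (evalC (L : Type) w) = isoGLAt S w.1 := by
  rw [val_archGL, Matrix.map_map]
  rfl

/-- `c ⊗ 1` through `w` is complex conjugation (CM: `c` fixes every place and `c ≠ 1`). -/
theorem evalC_comp_conjMixed (w : {w : InfinitePlace (L : Type) // w.IsComplex}) :
    (⇑(evalC (L : Type) w) ∘ ⇑(conjMixed (↥(maximalRealSubfield (L : Type))) (L : Type) (IsCMField.complexConj (L : Type)))) =
      (⇑(starRingEnd ℂ) ∘ ⇑(evalC (L : Type) w)) := by
  funext x
  exact evalC_conjMixed _ _ _ (complexConj_smul_infinitePlace (L : Type) w.1) (IsCMField.complexConj_ne_one (L : Type)) x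

/-- `((X.map (c ⊗ 1))ᵀ)` through `w` is `X(w)ᴴ`. -/
theorem map_conjMixed_transpose_map_evalC {m n : Type} (X : Matrix m n (mixedSpace (L : Type)))
    (w : {w : InfinitePlace (L : Type) // w.IsComplex}) :
    ((X.map (conjMixed (↥(maximalRealSubfield (L : Type))) (L : Type) (IsCMField.complexConj (L : Type))))ᵀ).map (evalC (L : Type) w) =
      (X.map (evalC (L : Type) w))ᴴ := by
  rw [Matrix.transpose_map, Matrix.map_map, evalC_comp_conjMixed, ← Matrix.map_map]
  ext i j
  simp [Matrix.conjTranspose_apply, Matrix.transpose_apply, Matrix.map_apply]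

/-- **`k = g₀,∞ · P_σ · Λ` lies in `U(diag(a₀,a₁))(L⁺ ⊗ ℝ)`**. -/
theorem archGL_mul_conjTransportGL_mem_arch :
    archGL (L : Type) S.isoGL * conjTransportGL S ∈
      UnitaryGroup.arch (↥(maximalRealSubfield (L : Type))) (L : Type) (IsCMField.complexConj (L : Type)) 2 (Matrix.diagonal (dW S)) := by
  rw [mem_arch_iff]
  refine matrix_mixedSpace_eq_of_evalC _ _ fun w => ?_
  rw [Matrix.map_mul, Matrix.map_mul, map_conjMixed_transpose_map_evalC, archFormOf_map_evalC,
    Matrix.diagonal_map (map_zero _), Units.val_mul, Matrix.map_mul, val_archGL_map_evalC, val_conjTransportGL, transportMat_map_evalC,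
    Matrix.conjTranspose_mul]
  calc (transportMatAt S w.1)ᴴ * (isoGLAt S w.1)ᴴ * Matrix.diagonal (fun j => w.1.embedding (dW S j)) * (isoGLAt S w.1 * transportMatAt S w.1)
      = (transportMatAt S w.1)ᴴ * ((isoGLAt S w.1)ᴴ * Matrix.diagonal (fun j => w.1.embedding (dW S j)) * isoGLAt S w.1) *
          transportMatAt S w.1 := by simp only [Matrix.mul_assoc]
    _ = Matrix.diagonal (fun j => w.1.embedding (dW S j)) := by rw [isoGLAt_gram, transportMatAt_gram]

/-- **the transport element `k ∈ U(diag(a₀,a₁))(L⁺ ⊗ ℝ)`** (#1217's `k`). -/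
def conjTransportK :
    ↥(UnitaryGroup.arch (↥(maximalRealSubfield (L : Type))) (L : Type) (IsCMField.complexConj (L : Type)) 2 (Matrix.diagonal (dW S))) :=
  ⟨archGL (L : Type) S.isoGL * conjTransportGL S, archGL_mul_conjTransportGL_mem_arch S⟩

/-- (Ported verbatim from the HodgeCMPerL package; no docstring in the source.) -/
@[simp] theorem coe_conjTransportK :
    ((conjTransportK S : ↥(UnitaryGroup.arch (↥(maximalRealSubfield (L : Type))) (L : Type) (IsCMField.complexConj (L : Type)) 2
      (Matrix.diagonal (dW S)))) : GL (Fin 2) (mixedSpace (L : Type))) = archGL (L : Type) S.isoGL * conjTransportGL S := rfl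

/-- the torus element through `w`: `diag(ι_w(u₁,w), ι_w(u₂,w))`. -/
theorem val_archDiagGL_map_evalC (u : NumberField.SeesawArchTorus (L : Type)) (w : {w : InfinitePlace (L : Type) // w.IsComplex}) :
    ((archDiagGL (L : Type) u : GL (Fin 2) (mixedSpace (L : Type))) : Matrix (Fin 2) (Fin 2) (mixedSpace (L : Type))).map (evalC (L : Type) w) =
      Matrix.diagonal ![((archPlaceChar (L : Type) w.1 (NumberField.SeesawArchTorus.fst (L : Type) u) : Circle) : ℂ),
        ((archPlaceChar (L : Type) w.1 (NumberField.SeesawArchTorus.snd (L : Type) u) : Circle) : ℂ)] := by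
  rw [val_archDiagGL, Matrix.diagonal_map (map_zero _)]
  congr 1
  funext j
  fin_cases j <;> rfl

/-- **`P_σ Λ · diag(ρ u) = diag(u) · P_σ Λ` in `GL₂(L ⊗ ℝ)`**. -/
theorem conjTransportGL_mul_archDiagGL (u : NumberField.SeesawArchTorus (L : Type)) :
    conjTransportGL S * archDiagGL (L : Type) (conjTorusRelabel S u) = archDiagGL (L : Type) u * conjTransportGL S := by
  apply Units.ext
  rw [Units.val_mul, Units.val_mul]
  refine matrix_mixedSpace_eq_of_evalC _ _ fun w => ?_
  rw [Matrix.map_mul, Matrix.map_mul, val_conjTransportGL, transportMat_map_evalC, val_archDiagGL_map_evalC, val_archDiagGL_map_evalC,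
    fst_conjTorusRelabel, snd_conjTorusRelabel, coe_archPlaceChar_mixAt, coe_archPlaceChar_mixAt]
  exact transportMatAt_mul_diagonal S w.1 _ _

/-- **THE TRANSPORT IDENTITY (#1217's `hk`)**: `g₀ · diag(u) · g₀⁻¹ = k · diag(ρ u) · k⁻¹` in `U(diag(a₀,a₁))(L⁺ ⊗ ℝ)`. -/
theorem archConjDiag_eq_conjTransport (u : NumberField.SeesawArchTorus (L : Type)) :
    archConjDiag (L : Type) S.isoGL (dW S) (dW' S) (isoGL_hg₀ S) u =
      conjTransportK S * archDiag (L : Type) (dW S) (conjTorusRelabel S u) * (conjTransportK S)⁻¹ := by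
  apply Subtype.ext
  change archGL (L : Type) S.isoGL * archDiagGL (L : Type) u * (archGL (L : Type) S.isoGL)⁻¹ =
    archGL (L : Type) S.isoGL * conjTransportGL S * archDiagGL (L : Type) (conjTorusRelabel S u) * (archGL (L : Type) S.isoGL * conjTransportGL S)⁻¹
  have h : conjTransportGL S * archDiagGL (L : Type) (conjTorusRelabel S u) * (conjTransportGL S)⁻¹ = archDiagGL (L : Type) u :=
    mul_inv_eq_iff_eq_mul.2 (conjTransportGL_mul_archDiagGL S u)
  rw [← h, mul_inv_rev]
  simp only [mul_assoc]

end Transport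

/-! ## §4 at a context: the datum for #1217's socket -/

section Ctx

variable {L : CMField} {ι₁ : L →+* ℂ} (V : HermSpace3 L ι₁) (c : SeesawCtx L)
variable
  (hGR : (cmSplittingDatum (L : Type) finProdFinEquiv (frameD V) (frameD_real V) (frameD_ne V) (dW c.D) (dW_real c.D) (dW_ne c.D)).CompatibleSplitting)
  (h₁W : (∀ j, 0 < (ι₁ (dW c.D j)).re) ∨ ∀ j, (ι₁ (dW c.D j)).re < 0)
  (hpos₀ : 0 < cmXW (L : Type) (frameD V) (lineVec (L : Type) (dW c.D 0)) (fun _ => dW_real c.D 0) ι₁ (HypCensus.cmPlace (L : Type) ι₁) 0)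
  (hpos₁ : 0 < cmXW (L : Type) (frameD V) (lineVec (L : Type) (dW c.D 1)) (fun _ => dW_real c.D 1) ι₁ (HypCensus.cmPlace (L : Type) ι₁) 0)

/-- **`hk` at a context** (literally #1217's hypothesis, with `k := conjTransportK c.D`, `ρ := conjTorusRelabel c.D`). -/
theorem ctx_archConjDiag_eq_conjTransport (u : NumberField.SeesawArchTorus (L : Type)) :
    archConjDiag (L : Type) c.D.isoGL (dW c.D) (dW' c.D) (isoGL_hg₀ c.D) u =
      conjTransportK c.D * archDiag (L : Type) (dW c.D) (conjTorusRelabel c.D u) * (conjTransportK c.D)⁻¹ :=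
  archConjDiag_eq_conjTransport c.D u

/-- **`hχρ` at a context** for the plane character `χ u = archWeight boxType₀ (u₀) · archWeight boxType₁ (u₁)` of (BT)
(`ctxSlotArchBox_harch`): the `ρ`-relabelled tables are `n₂ = relabel₀ c.D boxType₀ boxType₁`, `n₃ = relabel₁ c.D boxType₀ boxType₁`. -/
theorem ctx_archWeight_conjTorusRelabel (t₀ t₁ : ↥(relNormOneInfUnits (↥(maximalRealSubfield (L : Type))) (L : Type))) :
    archWeight (L : Type) (boxType₀ V c.D hGR h₁W)
          (NumberField.SeesawArchTorus.fst (L : Type) (conjTorusRelabel c.D (NumberField.SeesawArchTorus.mk (L : Type) t₀ t₁))) *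
        archWeight (L : Type) (boxType₁ V c.D hGR h₁W)
          (NumberField.SeesawArchTorus.snd (L : Type) (conjTorusRelabel c.D (NumberField.SeesawArchTorus.mk (L : Type) t₀ t₁))) =
      archWeight (L : Type) (relabel₀ c.D (boxType₀ V c.D hGR h₁W) (boxType₁ V c.D hGR h₁W)) t₀ *
        archWeight (L : Type) (relabel₁ c.D (boxType₀ V c.D hGR h₁W) (boxType₁ V c.D hGR h₁W)) t₁ :=
  archWeight_conjTorusRelabel c.D _ _ t₀ t₁

/-- the relabelled tables MINUS the plane's first table, in closed form at each place: `0` where the bit is clear,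
`boxType₁ − boxType₀` where it is set (first socket output `n₂ − m₀`) — and `boxType₁ − boxType₀ = slotTypeVec 1 − slotTypeVec 0`
is (TT)'s `slotDelta`. -/
theorem relabel₀_sub_apply (m₀ m₁ : InfinitePlace (L : Type) → ℤ) (w : InfinitePlace (L : Type)) :
    relabel₀ c.D m₀ m₁ w - m₀ w = if conjSwapAt c.D w then m₁ w - m₀ w else 0 := by
  unfold relabel₀; split_ifs <;> ring

/-- (Ported verbatim from the HodgeCMPerL package; no docstring in the source.) -/
theorem relabel₁_sub_apply (m₀ m₁ : InfinitePlace (L : Type) → ℤ) (w : InfinitePlace (L : Type)) :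
    relabel₁ c.D m₀ m₁ w - m₀ w = if conjSwapAt c.D w then 0 else m₁ w - m₀ w := by
  unfold relabel₁; split_ifs <;> ring

end Ctx

end HodgeCM.Model.ArchSideTerm

end
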